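import Summits.CriticalPhenomena.PercolationContinuityZ3.Theorems.PercNearOneGluingNoHeavyLowerTailSunflowerBlowup
import HarnessLib

/-!
# `NoHeavyLowerTail` (crux stmt-CriticalPhenomena-4575), abstract sunflower cubic: the ANDRÁSFAI GRAPHS ARE A-SAFE, part 1a —
# the cyclic order on `Fin n` and the circular-arc model (arcs, the graph, Helly on the circle, the core)

Support file (seat `prim-ineq-prove-1` gen 42; `--supports stmt-CriticalPhenomena-4575`).  No `sorry`, no named facts, standard axioms.
Memo: run/shared/lean/prim/prim-ineq-prove-1/FINDING-BLOWUP-prove1-g42.md §5 (arc model), §7 (the theorem and its proof).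

THE PROGRAMME (files `…SunflowerAndrasfai*`).  THEOREM (memo §7): for every `k` the graph core of the Andrásfai graph is safe for
every product measure (conjecture (And) of `…SunflowerAndrasfai`), hence (…SunflowerBlowup, …BlowupHom) so is the core of every
blow-up of an Andrásfai graph and of every maximal triangle-free graph homomorphic to one.  The proof: polarisation
(`SafeCalc.safe_of_disjoint_famIn`) reduces safety to `∏_j Λ(C_j) ≤ Λ(∅)^(K-1)` for colourings of the ARCS (= maximal independent
sets) — part 1b; an induction on the number of colour changes recolours one of two adjacent light runs (parts 2, 4); the one
inequality needed, the INTERVAL MERGING LEMMA, is an explicit weight-preserving injection (part 3).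

THIS FILE.  The cyclic order on `Fin n`: forward distance `fd`, shift `sh` and their arithmetic (`sh_fd`, `fd_sh`, `fd_add_fd`,
`fd_sub`, `fd_add_fd_rev`); the CIRCULAR-ARC MODEL on `Fin (3k+2)`: the arcs `arc k t = {x | fd t x ≤ k}` (the `k+1` consecutive points
from `t`), `arcGraph k` (adjacent iff in no common arc — the Andrásfai graph `And_{k+1}` in its distance presentation, the complement
of the `k`-th power of the `(3k+2)`-cycle); **`exists_arc_of_pairwise_coarc`** (Helly on the circle: a set whose points lie pairwise
in common arcs lies in one arc), so the independent sets are exactly the subsets of arcs and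
`edgeCore (arcGraph k) = {ω | ω lies in no arc}` (`mem_edgeCore_arcGraph_iff`).
-/

noncomputable section

namespace Summit.CriticalPhenomena.PercolationContinuityZ3.Theorems.SunflowerPartition

namespace SafeCalc

open Finset

namespace Arc

/-! ## A toolkit for the cyclic order on `Fin n`: forward distance and shift -/

section Cyclic

variable {n : ℕ} [NeZero n]

/-- Forward (cyclic) distance from `a` to `b` in `Fin n`: the number of successor steps from `a` to `b`. [this work] -/
def fd (a b : Fin n) : ℕ := ((b - a : Fin n) : ℕ)

/-- Shift forward by `j` steps on the cycle `Fin n`. [this work] -/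
def sh (a : Fin n) (j : ℕ) : Fin n := ⟨((a : ℕ) + j) % n, Nat.mod_lt _ (Nat.pos_of_ne_zero (NeZero.ne n))⟩

omit [NeZero n] in
/-- Forward distances are `< n`. -/
theorem fd_lt (a b : Fin n) : fd a b < n := (b - a).isLt

/-- `fd a a = 0`. -/
theorem fd_self (a : Fin n) : fd a a = 0 := by simp [fd]

/-- `fd a b = 0 ↔ a = b`. -/
theorem fd_eq_zero_iff {a b : Fin n} : fd a b = 0 ↔ a = b := by
  unfold fd
  constructor
  · intro h
    have : b - a = 0 := Fin.ext (by simpa using h)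
    exact (sub_eq_zero.1 this).symm
  · rintro rfl; simp

omit [NeZero n] in
/-- Forward distance in terms of values. -/
theorem fd_val (a b : Fin n) : fd a b = if a ≤ b then (b : ℕ) - a else n + b - a := by
  unfold fd
  split_ifs with h
  · exact Fin.coe_sub_iff_le.2 h
  · exact Fin.coe_sub_iff_lt.2 (lt_of_not_ge h)

omit [NeZero n] in
/-- Going there and back is one full turn. -/
theorem fd_add_fd_rev {a b : Fin n} (h : a ≠ b) : fd a b + fd b a = n := by
  rw [fd_val, fd_val]
  have ha := a.isLt; have hb := b.isLt
  have hne : (a : ℕ) ≠ b := fun e => h (Fin.ext e)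
  split_ifs with h1 h2 h2
  · exact absurd (le_antisymm h1 h2) (fun e => h e)
  · rw [Fin.le_def] at h1; omega
  · rw [Fin.le_def] at h2; omega
  · exact absurd (le_of_lt (lt_of_not_ge h1)) h2

omit [NeZero n] in
/-- The backward distance. -/
theorem fd_rev_eq {a b : Fin n} (h : a ≠ b) : fd b a = n - fd a b := by
  have := fd_add_fd_rev h; omega

/-- Value of a shift. -/
@[simp] theorem sh_val (a : Fin n) (j : ℕ) : ((sh a j : Fin n) : ℕ) = ((a : ℕ) + j) % n := rfl

/-- `sh a 0 = a`. -/
theorem sh_zero (a : Fin n) : sh a 0 = a := Fin.ext (by simp [Nat.mod_eq_of_lt a.isLt])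

/-- Shifts compose additively. -/
theorem sh_sh (a : Fin n) (i j : ℕ) : sh (sh a i) j = sh a (i + j) := by
  apply Fin.ext; simp only [sh_val]; rw [Nat.mod_add_mod, add_assoc]

/-- A full turn is the identity. -/
theorem sh_n (a : Fin n) : sh a n = a := Fin.ext (by simp [Nat.mod_eq_of_lt a.isLt])

/-- Walking forward by the forward distance reaches the target. -/
theorem sh_fd (a b : Fin n) : sh a (fd a b) = b := by
  apply Fin.ext
  rw [sh_val, fd_val]
  have ha := a.isLt; have hb := b.isLt
  split_ifs with h
  · rw [Fin.le_def] at h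
    rw [show (a : ℕ) + (b - a) = b by omega]
    exact Nat.mod_eq_of_lt hb
  · rw [Fin.le_def] at h
    rw [show (a : ℕ) + (n + b - a) = n + b by omega, Nat.add_mod_left]
    exact Nat.mod_eq_of_lt hb

/-- The forward distance to `sh a j` is `j` (`j < n`). -/
theorem fd_sh (a : Fin n) {j : ℕ} (hj : j < n) : fd a (sh a j) = j := by
  rw [fd_val]
  have ha := a.isLt
  have hv : ((sh a j : Fin n) : ℕ) = (a + j) % n := sh_val a j
  split_ifs with h
  · rw [Fin.le_def, hv] at h
    rw [hv]
    by_cases hlt : (a : ℕ) + j < n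
    · rw [Nat.mod_eq_of_lt hlt]; omega
    · rw [Nat.mod_eq_sub_mod (by omega), Nat.mod_eq_of_lt (by omega)] at h ⊢
      omega
  · rw [Fin.le_def, hv] at h
    rw [hv]
    by_cases hlt : (a : ℕ) + j < n
    · rw [Nat.mod_eq_of_lt hlt] at h ⊢; omega
    · rw [Nat.mod_eq_sub_mod (by omega), Nat.mod_eq_of_lt (by omega)] at h ⊢
      omega

/-- `sh a` is injective on `[0, n)`. -/
theorem sh_inj (a : Fin n) {i j : ℕ} (hi : i < n) (hj : j < n) (h : sh a i = sh a j) : i = j := by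
  have := fd_sh a hi; rw [h, fd_sh a hj] at this; exact this.symm

/-- Additivity of forward distances along a short path. -/
theorem fd_add_fd {a b c : Fin n} (h : fd a b + fd b c < n) : fd a b + fd b c = fd a c := by
  have : c = sh a (fd a b + fd b c) := by
    rw [← sh_sh, sh_fd a b, sh_fd b c]
  conv_rhs => rw [this]
  rw [fd_sh a h]

/-- If `b` is met no later than `c` when walking from `a`, then `fd b c = fd a c - fd a b`. -/
theorem fd_sub {a b c : Fin n} (h : fd a b ≤ fd a c) : fd b c = fd a c - fd a b := by
  have hlt : fd a c - fd a b < n := lt_of_le_of_lt (Nat.sub_le _ _) (fd_lt a c)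
  have : c = sh b (fd a c - fd a b) := by
    have e1 : sh a (fd a b) = b := sh_fd a b
    calc c = sh a (fd a c) := (sh_fd a c).symm
      _ = sh a (fd a b + (fd a c - fd a b)) := by congr 1; omega
      _ = sh (sh a (fd a b)) (fd a c - fd a b) := (sh_sh _ _ _).symm
      _ = sh b (fd a c - fd a b) := by rw [e1]
  conv_lhs => rw [this]
  rw [fd_sh b hlt]

/-- Distance from a point met earlier: if `fd a b ≤ fd a c` then `fd c b = n - (fd a c - fd a b)` unless `b = c`. -/
theorem fd_sub_rev {a b c : Fin n} (h : fd a b ≤ fd a c) (hbc : b ≠ c) : fd c b = n - (fd a c - fd a b) := by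
  rw [fd_rev_eq hbc, fd_sub h]

end Cyclic

/-! ## The circular-arc model of the Andrásfai graph on `Fin (3k+2)` -/

/-- `3k+2 ≠ 0`. -/
instance neZero_three_mul_add_two (k : ℕ) : NeZero (3 * k + 2) := ⟨by omega⟩

variable (k : ℕ)

/-- The ARC starting at `t`: the `k+1` cyclically consecutive points `t, t+1, …, t+k`. [this work] -/
def arc (t : Fin (3 * k + 2)) : Finset (Fin (3 * k + 2)) := univ.filter fun x => fd t x ≤ k

/-- Two points are CO-ARC if one is at forward distance `≤ k` from the other (equivalently: some arc contains both). [this work] -/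
def Coarc (u v : Fin (3 * k + 2)) : Prop := fd u v ≤ k ∨ fd v u ≤ k

/-- The Andrásfai graph `And_{k+1}` in its circular-distance presentation: `u ~ v` iff `u, v` lie in no common arc, i.e. both
forward distances exceed `k` (the complement of the `k`-th power of the `(3k+2)`-cycle). [this work] -/
def arcGraph : SimpleGraph (Fin (3 * k + 2)) where
  Adj u v := ¬ Coarc k u v
  symm := ⟨fun _ _ h h' => h h'.symm⟩
  loopless := ⟨fun _ h => h (Or.inl (by rw [fd_self]; exact Nat.zero_le _))⟩

variable {k}

/-- Membership in an arc. -/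
@[simp] theorem mem_arc {t x : Fin (3 * k + 2)} : x ∈ arc k t ↔ fd t x ≤ k := by
  simp [arc]

/-- The start belongs to its arc. -/
theorem self_mem_arc (t : Fin (3 * k + 2)) : t ∈ arc k t := by
  rw [mem_arc, fd_self]; exact Nat.zero_le _

/-- Adjacency in `arcGraph`. -/
theorem arcGraph_adj {u v : Fin (3 * k + 2)} : (arcGraph k).Adj u v ↔ k < fd u v ∧ k < fd v u := by
  change ¬ Coarc k u v ↔ _
  unfold Coarc
  omega

/-- Two points of one arc are co-arc. -/
theorem coarc_of_mem_arc {t u v : Fin (3 * k + 2)} (hu : u ∈ arc k t) (hv : v ∈ arc k t) : Coarc k u v := by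
  rw [mem_arc] at hu hv
  rcases le_total (fd t u) (fd t v) with h | h
  · left; rw [fd_sub h]; omega
  · right; rw [fd_sub h]; omega

/-- Co-arc points lie in a common arc. -/
theorem coarc_iff_exists_arc {u v : Fin (3 * k + 2)} : Coarc k u v ↔ ∃ t, u ∈ arc k t ∧ v ∈ arc k t := by
  constructor
  · rintro (h | h)
    · exact ⟨u, self_mem_arc u, mem_arc.2 h⟩
    · exact ⟨v, mem_arc.2 h, self_mem_arc v⟩
  · rintro ⟨t, hu, hv⟩
    exact coarc_of_mem_arc hu hv

/-- **Helly on the circle.**  A set of points lying pairwise in common arcs lies in one arc.  (Fix `u ∈ S`; every point is at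
forward or backward distance `≤ k` from `u`; let `d⁻, d⁺` be the largest such distances, attained at `v⁻, v⁺`.  If `d⁻ + d⁺ ≤ k`
the arc starting at `v⁻` contains `S`; otherwise `v⁻, v⁺` are at forward distances `d⁻ + d⁺ > k` and `3k+2-(d⁻+d⁺) > k` — not
co-arc.) [this work] -/
theorem exists_arc_of_pairwise_coarc {S : Finset (Fin (3 * k + 2))} (hS : ∀ u ∈ S, ∀ v ∈ S, Coarc k u v) :
    ∃ t, S ⊆ arc k t := by
  classical
  rcases S.eq_empty_or_nonempty with rfl | ⟨u, hu⟩
  · exact ⟨0, empty_subset _⟩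
  set Bh := S.filter fun v => fd v u ≤ k with hBh
  set Ah := S.filter fun v => fd u v ≤ k with hAh
  have huB : u ∈ Bh := by rw [hBh, mem_filter, fd_self]; exact ⟨hu, Nat.zero_le _⟩
  have huA : u ∈ Ah := by rw [hAh, mem_filter, fd_self]; exact ⟨hu, Nat.zero_le _⟩
  obtain ⟨vm, hvm, hvmax⟩ := exists_max_image Bh (fun v => fd v u) ⟨u, huB⟩
  obtain ⟨vp, hvp, hvpax⟩ := exists_max_image Ah (fun v => fd u v) ⟨u, huA⟩
  rw [hBh, mem_filter] at hvm
  rw [hAh, mem_filter] at hvp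
  have hN : 0 < 3 * k + 2 := by omega
  by_cases hsum : fd vm u + fd u vp ≤ k
  · refine ⟨vm, fun v hv => mem_arc.2 ?_⟩
    rcases hS u hu v hv with h | h
    · -- `v` ahead of `u`
      have hle : fd u v ≤ fd u vp := hvpax v (by rw [hAh, mem_filter]; exact ⟨hv, h⟩)
      have hlt : fd vm u + fd u v < 3 * k + 2 := by omega
      rw [← fd_add_fd hlt]; omega
    · -- `v` behind `u`
      have hle : fd v u ≤ fd vm u := hvmax v (by rw [hBh, mem_filter]; exact ⟨hv, h⟩)
      by_cases hvu : v = u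
      · subst hvu; omega
      by_cases hmu : vm = u
      · rw [hmu] at hle ⊢
        have : fd v u = 0 := by rw [fd_self] at hle; omega
        rw [fd_eq_zero_iff] at this
        rw [this, fd_self]; exact Nat.zero_le _
      have e1 : fd u v = 3 * k + 2 - fd v u := fd_rev_eq hvu
      have e2 : fd u vm = 3 * k + 2 - fd vm u := fd_rev_eq hmu
      have hle' : fd u vm ≤ fd u v := by rw [e1, e2]; omega
      rw [fd_sub hle', e1, e2]
      have := fd_lt v u; have := fd_lt vm u
      omega
  · exfalso
    push Not at hsum
    have hlt : fd vm u + fd u vp < 3 * k + 2 := by omega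
    have e := fd_add_fd hlt
    have hne : vm ≠ vp := by
      intro h; rw [h, fd_self] at e; omega
    have h1 : k < fd vm vp := by rw [← e]; exact hsum
    have h2 : k < fd vp vm := by rw [fd_rev_eq hne, ← e]; omega
    rcases hS vm hvm.1 vp hvp.1 with h | h
    · exact absurd h (not_le.2 h1)
    · exact absurd h (not_le.2 h2)

/-- A set is SMALL if it lies in some arc. [this work] -/
def Small (S : Finset (Fin (3 * k + 2))) : Prop := ∃ t, S ⊆ arc k t

/-- Independent sets of `arcGraph` = small sets. [this work] -/
theorem small_iff_pairwise_not_adj {S : Finset (Fin (3 * k + 2))} :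
    Small (k := k) S ↔ ∀ u ∈ S, ∀ v ∈ S, ¬ (arcGraph k).Adj u v := by
  constructor
  · rintro ⟨t, ht⟩ u hu v hv h
    exact h (coarc_of_mem_arc (ht hu) (ht hv))
  · intro h
    exact exists_arc_of_pairwise_coarc fun u hu v hv => not_not.1 (h u hu v hv)

/-- **The graph core of `arcGraph k` consists of the sets lying in no arc.** [this work] -/
theorem mem_edgeCore_arcGraph_iff (S : Finset (Fin (3 * k + 2))) :
    (↑S : Set (Fin (3 * k + 2))) ∈ edgeCore (arcGraph k) ↔ ¬ Small (k := k) S := by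
  rw [small_iff_pairwise_not_adj]
  simp only [edgeCore, Set.mem_setOf_eq, Finset.mem_coe]
  constructor
  · rintro ⟨u, v, huv, hu, hv⟩ h
    exact h u hu v hv huv
  · intro h
    by_contra hne
    push Not at hne
    exact h fun u hu v hv huv => hne u v huv hu hv

end Arc

end SafeCalc

end Summit.CriticalPhenomena.PercolationContinuityZ3.Theorems.SunflowerPartition
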